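import Summits.Ventures.PercRepro.ProfilePointedCircuitClassesStarSharpPencilG

/-!
# PercRepro — THE PENCIL THROUGH `ℓ ∈ X`, PART H: THE C-POINTS OF THE F-CLASS
(p5, gen 56; `proofs/P5-GM1.md` §83)

The C-points owned by the bad demands of the F-class (pairs on the plane `P_f = cl{e, f, ℓ}`): a bad demand
`{ℓ, a} + e + b` makes `ℓ` a C-point (when `X − ℓ` has rank 4) or `a` (`pencilX_F_la_cpoint`: then the demand is a
B2 defect, `a` is off the line `ef` and `ℓ` is off the plane `cl(X − ℓ − a)`); a bad demand `{a, a′} + e + b` makes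
`a` or `a′` a C-point (`pencilX_F_aa'_cpoint`); two points of `P_f` on the line `ef` carry no demand `{a, a′}`
(`pencilX_F_not_aa'_of_line_ef`) and at most one bad demand with `ℓ` (`pencilX_F_not_both_la`: two B1 defects would
put `e` on the line `cd` of the two remaining points).
-/

open scoped Matroid

namespace PercRepro.Cogirth

open Finset ThmH Skew Shadow Profile

open Classical

variable {α : Type} [DecidableEq α] {N : Matroid α} [N.Finite]

section StarSharpPencilH

variable {b b' : α}

/-- `{e, a} + f = {e, f, a}`. -/
theorem insert_f_ea_eq (e f a : α) : insert f ({e, a} : Finset α) = {e, f, a} := by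
  ext z; simp only [mem_insert, mem_singleton]; tauto

/-- `{f, a} ⊆ ({ℓ, a} + f) ∩ {e, f, a}`. -/
theorem pair_fa_subset_inter_lfa_efa (e f l a : α) :
    ({f, a} : Finset α) ⊆ insert f {l, a} ∩ {e, f, a} := by
  intro z hz; simp only [mem_inter, mem_insert, mem_singleton] at hz ⊢; tauto

/-- `{e, f, ℓ} ⊆ ({ℓ, a} + f) ∪ {e, f, a}`. -/
theorem efl_subset_union_lfa_efa (e f l a : α) :
    ({e, f, l} : Finset α) ⊆ insert f {l, a} ∪ {e, f, a} := by
  intro z hz; simp only [mem_union, mem_insert, mem_singleton] at hz ⊢; tauto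

/-- `{e, f} ⊆ {e, f, a} ∩ {e, f, a′}`. -/
theorem pair_ef_subset_inter_efa_efa' (e f a a' : α) :
    ({e, f} : Finset α) ⊆ {e, f, a} ∩ {e, f, a'} := by
  intro z hz; simp only [mem_inter, mem_insert, mem_singleton] at hz ⊢; tauto

/-- `{a, a′} + e ⊆ {e, f, a} ∪ {e, f, a′}`. -/
theorem insert_e_pair_subset_union_efa_efa' (e f a a' : α) :
    insert e ({a, a'} : Finset α) ⊆ {e, f, a} ∪ {e, f, a'} := by
  intro z hz; simp only [mem_union, mem_insert, mem_singleton] at hz ⊢; tauto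

/-- `{f, a} ⊆ {e, f, a} ∩ ({a, a′} + f)`. -/
theorem pair_fa_subset_inter_efa_faa' (e f a a' : α) :
    ({f, a} : Finset α) ⊆ {e, f, a} ∩ insert f {a, a'} := by
  intro z hz; simp only [mem_inter, mem_insert, mem_singleton] at hz ⊢; tauto

/-- `{a, a′} + e ⊆ {e, f, a} ∪ ({a, a′} + f)`. -/
theorem insert_e_pair_subset_union_efa_faa' (e f a a' : α) :
    insert e ({a, a'} : Finset α) ⊆ {e, f, a} ∪ insert f {a, a'} := by
  intro z hz; simp only [mem_union, mem_insert, mem_singleton] at hz ⊢; tauto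

/-- **TWO POINTS ON THE LINE `ef` SPAN NO PLANE WITH `e`**: `ρ{e, f, a} = ρ{e, f, a′} = 2 ⟹ ρ({a, a′} + e) ≤ 2`. -/
theorem rk_insert_e_pair_le_two_of_line_ef {e f a a' : α} (hef2 : rk N {e, f} = 2) (ha : rk N {e, f, a} = 2)
    (ha' : rk N {e, f, a'} = 2) : rk N (insert e {a, a'}) ≤ 2 := by
  have h1 := rk_union_add_rk_le_of_subset_inter' (N := N) (S := {e, f, a}) (T := {e, f, a'}) (I := {e, f})
    (pair_ef_subset_inter_efa_efa' e f a a')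
  have h2 : rk N (insert e {a, a'}) ≤ rk N ({e, f, a} ∪ {e, f, a'}) :=
    rk_mono' (insert_e_pair_subset_union_efa_efa' e f a a')
  rw [hef2, ha, ha'] at h1
  omega

/-- **NO DEMAND `{a, a′}` WITH BOTH POINTS ON THE LINE `ef`.** -/
theorem pencilX_F_not_aa'_of_line_ef (hn : (gr N).card = 9) (h : SeriesPair N b b') {e f : α} (he : e ∈ gr N)
    (hf : f ∈ gr N) (hef : e ≠ f) (heb : e ≠ b) (heb' : e ≠ b') (hfb : f ≠ b) (hfb' : f ≠ b') (hef2 : rk N {e, f} = 2)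
    {a a' : α} (haX : a ∈ ((((gr N).erase b).erase b').erase f).erase e)
    (ha'X : a' ∈ ((((gr N).erase b).erase b').erase f).erase e)
    (hefa : rk N {e, f, a} = 2) (hefa' : rk N {e, f, a'} = 2) :
    insert b (insert e {a, a'}) ∉ d0DON N b' e f := by
  intro hW
  obtain ⟨hπe, -, -, -⟩ := d0DON_pair_data hn h he hf hef heb heb' hfb hfb' haX ha'X hW
  have := rk_insert_e_pair_le_two_of_line_ef (N := N) hef2 hefa hefa'
  omega

/-- **A BAD DEMAND `{ℓ, a} + e + b` OWNS A C-POINT**: `ℓ` (when `ρ(X − ℓ) = 4`) or `a`. -/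
theorem pencilX_F_la_cpoint (hn : (gr N).card = 9) (h : SeriesPair N b b') {e f : α} (he : e ∈ gr N)
    (hf : f ∈ gr N) (hef : e ≠ f) (heb : e ≠ b) (heb' : e ≠ b') (hfb : f ≠ b) (hfb' : f ≠ b')
    (he1 : ∀ y ∈ ((((gr N).erase b).erase b').erase f).erase e, rk N {e, y} = 2)
    (hf1 : ∀ y ∈ ((((gr N).erase b).erase b').erase f).erase e, rk N {f, y} = 2)
    (hfc : ∀ y ∈ ((((gr N).erase b).erase b').erase f).erase e, rk N (((((gr N).erase b).erase b').erase f).erase y) = 4)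
    (hX : rk N (((((gr N).erase b).erase b').erase f).erase e) = 4) (hef2 : rk N {e, f} = 2)
    {l : α} (hlX : l ∈ ((((gr N).erase b).erase b').erase f).erase e) (hlon : rk N (insert b (insert b' {e, l})) = 3)
    (hefl : rk N {e, f, l} = 3)
    {a : α} (haX : a ∈ ((((gr N).erase b).erase b').erase f).erase e) (hal : a ≠ l)
    (haP : rk N (insert a {e, f, l}) = 3)
    (hW : insert b (insert e {l, a}) ∈ d0DON N b' e f) (hc0 : ¬ d0c0 N b b' e f (insert b (insert e {l, a}))) :
    (rk N {e, f, l} = 3 ∧ rk N ((((((gr N).erase b).erase b').erase f).erase e).erase l) = 4) ∨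
    (rk N {e, f, a} = 3 ∧ rk N ((((((gr N).erase b).erase b').erase f).erase e).erase a) = 4) := by
  set X := ((((gr N).erase b).erase b').erase f).erase e with hXdef
  have hXg : X ⊆ gr N :=
    (erase_subset _ _).trans ((erase_subset _ _).trans ((erase_subset _ _).trans (erase_subset _ _)))
  have hdata := d0DON_pair_data hn h he hf hef heb heb' hfb hfb' hlX haX hW
  have hπe : rk N (insert e {l, a}) = 3 := hdata.1
  have hYf : rk N (insert f (X \ {l, a})) = 4 := hdata.2.1
  have hτ3 : rk N (X \ {l, a}) = 3 := hdata.2.2.1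
  have hlP : rk N (insert l {e, f, l}) = 3 := by
    rw [insert_eq_of_mem (mem_insert_of_mem (mem_insert_of_mem (mem_singleton_self _)))]; exact hefl
  have hB := pencilX_F_B1_or_B2 hn h he hf hef heb heb' hfb hfb' he1 hlX hlon hefl hlX haX hal.symm hlP haP hW hc0
  by_cases hY : rk N (X.erase l) = 4
  · exact Or.inl ⟨hefl, hY⟩
  · right
    have hsub : X \ {l, a} ⊆ X.erase l := by
      intro z hz
      rw [mem_sdiff] at hz
      simp only [mem_insert, mem_singleton, not_or] at hz
      exact mem_erase.2 ⟨hz.2.1, hz.1⟩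
    have hY3 : rk N (X.erase l) = 3 := by
      have h1 : rk N (X \ {l, a}) ≤ rk N (X.erase l) := rk_mono' hsub
      have h2 := rk_le_card' (M := N) (X.erase l)
      rw [card_erase_of_mem hlX, card_X_eq_five hn h he hf hef heb heb' hfb hfb'] at h2
      omega
    have hYe : rk N (insert e (X.erase l)) = 4 := by
      have := hfc l hlX
      rw [E7_erase_f_erase_eq_insert_e he hef heb heb' hlX] at this
      exact this
    -- not a B1 defect
    have hnB1 : ¬ rk N (insert e (X \ {l, a})) = 3 := by
      intro hB1
      have := rk_insert_eq_of_rk_insert_eq_subset' (N := N) (S := X \ {l, a}) (S' := X.erase l) hsub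
        (by rw [hB1, hτ3])
      rw [hYe, hY3] at this
      omega
    have hB2 : rk N (insert f {l, a}) = 2 := hB.resolve_right hnB1
    -- `a` is off the line `ef`
    have hefa : rk N {e, f, a} = 3 := by
      by_contra hne
      have h1 : rk N {e, f} ≤ rk N {e, f, a} := rk_mono' (pair_ef_subset_eft e f a)
      have h2 := rk_le_card' (M := N) ({e, f, a} : Finset α)
      have h3 := card_insert_le e ({f, a} : Finset α)
      have h4 := card_le_two (a := f) (b := a)
      have hefa2 : rk N {e, f, a} = 2 := by rw [hef2] at h1; omega
      have hsm := rk_union_add_rk_le_of_subset_inter' (N := N) (S := insert f {l, a}) (T := {e, f, a}) (I := {f, a})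
        (pair_fa_subset_inter_lfa_efa e f l a)
      have h5 : rk N {e, f, l} ≤ rk N (insert f {l, a} ∪ {e, f, a}) := rk_mono' (efl_subset_union_lfa_efa e f l a)
      rw [hB2, hefa2, hf1 a haX] at hsm
      rw [hefl] at h5
      omega
    refine ⟨hefa, ?_⟩
    -- `ℓ` is off the plane `cl(X − ℓ − a)`
    have hXa : X.erase a = insert l (X \ {l, a}) := by
      rw [erase_eq_insert_sdiff_pair hlX hal, pair_comm' a l]
    rw [hXa]
    by_contra hne
    have h1 : rk N (X \ {l, a}) ≤ rk N (insert l (X \ {l, a})) := rk_mono' (subset_insert _ _)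
    have h2 := rk_insert_le_add_one (N := N) (hXg hlX) (X := X \ {l, a}) (sdiff_subset.trans hXg)
    have hlcl : rk N (insert l (X \ {l, a})) = rk N (X \ {l, a}) := by omega
    have h3 := rk_insert_eq_of_rk_insert_eq_subset' (N := N) (S := X \ {l, a}) (S' := X.erase l) hsub hlcl
    rw [insert_erase hlX, hX, hY3] at h3
    omega

/-- The asymmetric core of `pencilX_F_aa'_cpoint`: a bad demand `{a, a′} + e + b` with `a` on the line `ef` makes
`a′` a C-point. -/
theorem pencilX_F_aa'_cpoint_aux (hn : (gr N).card = 9) (h : SeriesPair N b b') {e f : α} (he : e ∈ gr N)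
    (hf : f ∈ gr N) (hef : e ≠ f) (heb : e ≠ b) (heb' : e ≠ b') (hfb : f ≠ b) (hfb' : f ≠ b')
    (he1 : ∀ y ∈ ((((gr N).erase b).erase b').erase f).erase e, rk N {e, y} = 2)
    (hf1 : ∀ y ∈ ((((gr N).erase b).erase b').erase f).erase e, rk N {f, y} = 2)
    (hfc : ∀ y ∈ ((((gr N).erase b).erase b').erase f).erase e, rk N (((((gr N).erase b).erase b').erase f).erase y) = 4)
    (hef2 : rk N {e, f} = 2)
    {l : α} (hlX : l ∈ ((((gr N).erase b).erase b').erase f).erase e) (hlon : rk N (insert b (insert b' {e, l})) = 3)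
    (hefl : rk N {e, f, l} = 3)
    {a a' : α} (haX : a ∈ ((((gr N).erase b).erase b').erase f).erase e)
    (ha'X : a' ∈ ((((gr N).erase b).erase b').erase f).erase e) (haa' : a ≠ a')
    (haP : rk N (insert a {e, f, l}) = 3) (ha'P : rk N (insert a' {e, f, l}) = 3)
    (hW : insert b (insert e {a, a'}) ∈ d0DON N b' e f) (hc0 : ¬ d0c0 N b b' e f (insert b (insert e {a, a'})))
    (hefa : rk N {e, f, a} = 2) :
    rk N {e, f, a'} = 3 ∧ rk N ((((((gr N).erase b).erase b').erase f).erase e).erase a') = 4 := by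
  set X := ((((gr N).erase b).erase b').erase f).erase e with hXdef
  have hXg : X ⊆ gr N :=
    (erase_subset _ _).trans ((erase_subset _ _).trans ((erase_subset _ _).trans (erase_subset _ _)))
  have hdata := d0DON_pair_data hn h he hf hef heb heb' hfb hfb' haX ha'X hW
  have hπe : rk N (insert e {a, a'}) = 3 := hdata.1
  have hYf : rk N (insert f (X \ {a, a'})) = 4 := hdata.2.1
  have hτ3 : rk N (X \ {a, a'}) = 3 := hdata.2.2.1
  have hB := pencilX_F_B1_or_B2 hn h he hf hef heb heb' hfb hfb' he1 hlX hlon hefl haX ha'X haa' haP ha'P hW hc0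
  have hefa' : rk N {e, f, a'} = 3 := by
    by_contra hne
    have h1 : rk N {e, f} ≤ rk N {e, f, a'} := rk_mono' (pair_ef_subset_eft e f a')
    have h2 := rk_le_card' (M := N) ({e, f, a'} : Finset α)
    have h3 := card_insert_le e ({f, a'} : Finset α)
    have h4 := card_le_two (a := f) (b := a')
    have hefa'2 : rk N {e, f, a'} = 2 := by rw [hef2] at h1; omega
    have := rk_insert_e_pair_le_two_of_line_ef (N := N) hef2 hefa hefa'2
    omega
  refine ⟨hefa', ?_⟩
  by_contra hne
  have hXa' : X.erase a' = insert a (X \ {a, a'}) := by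
    rw [erase_eq_insert_sdiff_pair haX haa'.symm, pair_comm' a' a]
  have hsub : X \ {a, a'} ⊆ X.erase a' := by
    intro z hz
    rw [mem_sdiff] at hz
    simp only [mem_insert, mem_singleton, not_or] at hz
    exact mem_erase.2 ⟨hz.2.2, hz.1⟩
  have hY3 : rk N (X.erase a') = 3 := by
    have h1 : rk N (X \ {a, a'}) ≤ rk N (X.erase a') := rk_mono' hsub
    have h2 := rk_le_card' (M := N) (X.erase a')
    rw [card_erase_of_mem ha'X, card_X_eq_five hn h he hf hef heb heb' hfb hfb'] at h2
    omega
  have hYe : rk N (insert e (X.erase a')) = 4 := by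
    have := hfc a' ha'X
    rw [E7_erase_f_erase_eq_insert_e he hef heb heb' ha'X] at this
    exact this
  -- not a B1 defect
  have hnB1 : ¬ rk N (insert e (X \ {a, a'})) = 3 := by
    intro hB1
    have := rk_insert_eq_of_rk_insert_eq_subset' (N := N) (S := X \ {a, a'}) (S' := X.erase a') hsub
      (by rw [hB1, hτ3])
    rw [hYe, hY3] at this
    omega
  have hB2 : rk N (insert f {a, a'}) = 2 := hB.resolve_right hnB1
  -- `{e, f, a}` and `{a, a′} + f` of rank 2 sharing the line `fa` put `{a, a′} + e` on a line
  have hsm := rk_union_add_rk_le_of_subset_inter' (N := N) (S := {e, f, a}) (T := insert f {a, a'}) (I := {f, a})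
    (pair_fa_subset_inter_efa_faa' e f a a')
  have h5 : rk N (insert e {a, a'}) ≤ rk N ({e, f, a} ∪ insert f {a, a'}) :=
    rk_mono' (insert_e_pair_subset_union_efa_faa' e f a a')
  rw [hefa, hB2, hf1 a haX] at hsm
  omega

/-- **A BAD DEMAND `{a, a′} + e + b` OWNS A C-POINT**: `a` or `a′`. -/
theorem pencilX_F_aa'_cpoint (hn : (gr N).card = 9) (h : SeriesPair N b b') {e f : α} (he : e ∈ gr N)
    (hf : f ∈ gr N) (hef : e ≠ f) (heb : e ≠ b) (heb' : e ≠ b') (hfb : f ≠ b) (hfb' : f ≠ b')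
    (he1 : ∀ y ∈ ((((gr N).erase b).erase b').erase f).erase e, rk N {e, y} = 2)
    (hf1 : ∀ y ∈ ((((gr N).erase b).erase b').erase f).erase e, rk N {f, y} = 2)
    (hfc : ∀ y ∈ ((((gr N).erase b).erase b').erase f).erase e, rk N (((((gr N).erase b).erase b').erase f).erase y) = 4)
    (hX : rk N (((((gr N).erase b).erase b').erase f).erase e) = 4) (hef2 : rk N {e, f} = 2)
    {l : α} (hlX : l ∈ ((((gr N).erase b).erase b').erase f).erase e) (hlon : rk N (insert b (insert b' {e, l})) = 3)
    (hefl : rk N {e, f, l} = 3)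
    {a a' : α} (haX : a ∈ ((((gr N).erase b).erase b').erase f).erase e)
    (ha'X : a' ∈ ((((gr N).erase b).erase b').erase f).erase e) (haa' : a ≠ a')
    (haP : rk N (insert a {e, f, l}) = 3) (ha'P : rk N (insert a' {e, f, l}) = 3)
    (hW : insert b (insert e {a, a'}) ∈ d0DON N b' e f) (hc0 : ¬ d0c0 N b b' e f (insert b (insert e {a, a'}))) :
    (rk N {e, f, a} = 3 ∧ rk N ((((((gr N).erase b).erase b').erase f).erase e).erase a) = 4) ∨
    (rk N {e, f, a'} = 3 ∧ rk N ((((((gr N).erase b).erase b').erase f).erase e).erase a') = 4) := by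
  set X := ((((gr N).erase b).erase b').erase f).erase e with hXdef
  have hXg : X ⊆ gr N :=
    (erase_subset _ _).trans ((erase_subset _ _).trans ((erase_subset _ _).trans (erase_subset _ _)))
  have hdata := d0DON_pair_data hn h he hf hef heb heb' hfb hfb' haX ha'X hW
  have hπe : rk N (insert e {a, a'}) = 3 := hdata.1
  have hτ3 : rk N (X \ {a, a'}) = 3 := hdata.2.2.1
  have hW' : insert b (insert e {a', a}) ∈ d0DON N b' e f := by rw [pair_comm']; exact hW
  have hc0' : ¬ d0c0 N b b' e f (insert b (insert e {a', a})) := by rw [pair_comm']; exact hc0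
  by_cases hefa : rk N {e, f, a} = 2
  · exact Or.inr (pencilX_F_aa'_cpoint_aux hn h he hf hef heb heb' hfb hfb' he1 hf1 hfc hef2 hlX hlon hefl haX ha'X
      haa' haP ha'P hW hc0 hefa)
  by_cases hefa' : rk N {e, f, a'} = 2
  · exact Or.inl (pencilX_F_aa'_cpoint_aux hn h he hf hef heb heb' hfb hfb' he1 hf1 hfc hef2 hlX hlon hefl ha'X haX
      haa'.symm ha'P haP hW' hc0' hefa')
  have hefa3 : rk N {e, f, a} = 3 := by
    have h1 : rk N {e, f} ≤ rk N {e, f, a} := rk_mono' (pair_ef_subset_eft e f a)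
    have h2 := rk_le_card' (M := N) ({e, f, a} : Finset α)
    have h3 := card_insert_le e ({f, a} : Finset α)
    have h4 := card_le_two (a := f) (b := a)
    rw [hef2] at h1
    omega
  have hefa'3 : rk N {e, f, a'} = 3 := by
    have h1 : rk N {e, f} ≤ rk N {e, f, a'} := rk_mono' (pair_ef_subset_eft e f a')
    have h2 := rk_le_card' (M := N) ({e, f, a'} : Finset α)
    have h3 := card_insert_le e ({f, a'} : Finset α)
    have h4 := card_le_two (a := f) (b := a')
    rw [hef2] at h1
    omega
  by_contra hno
  push Not at hno
  have hYa : rk N (X.erase a) = 3 := by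
    have h1 : rk N (X \ {a, a'}) ≤ rk N (X.erase a) := by
      apply rk_mono'
      intro z hz
      rw [mem_sdiff] at hz
      simp only [mem_insert, mem_singleton, not_or] at hz
      exact mem_erase.2 ⟨hz.2.1, hz.1⟩
    have h2 := rk_le_card' (M := N) (X.erase a)
    rw [card_erase_of_mem haX, card_X_eq_five hn h he hf hef heb heb' hfb hfb'] at h2
    have := hno.1 hefa3
    omega
  have hYa' : rk N (X.erase a') = 3 := by
    have h1 : rk N (X \ {a, a'}) ≤ rk N (X.erase a') := by
      apply rk_mono'
      intro z hz
      rw [mem_sdiff] at hz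
      simp only [mem_insert, mem_singleton, not_or] at hz
      exact mem_erase.2 ⟨hz.2.2, hz.1⟩
    have h2 := rk_le_card' (M := N) (X.erase a')
    rw [card_erase_of_mem ha'X, card_X_eq_five hn h he hf hef heb heb' hfb hfb'] at h2
    have := hno.2 hefa'3
    omega
  -- `a, a′ ∈ cl(X ∖ {a, a′})`, so `X` has rank 3
  have hXa : X.erase a = insert a' (X \ {a, a'}) := erase_eq_insert_sdiff_pair ha'X haa'
  have hXa' : X.erase a' = insert a (X \ {a, a'}) := by
    rw [erase_eq_insert_sdiff_pair haX haa'.symm, pair_comm' a' a]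
  have hall : ∀ z ∈ ({a, a'} : Finset α), rk N (insert z (X \ {a, a'})) = rk N (X \ {a, a'}) := by
    intro z hz
    simp only [mem_insert, mem_singleton] at hz
    rcases hz with rfl | rfl
    · rw [← hXa', hYa', hτ3]
    · rw [← hXa, hYa, hτ3]
  have h5 := rk_union_eq_of_forall_insert_eq (N := N) (Y := X \ {a, a'}) {a, a'} hall
  have h6 : rk N X ≤ rk N (X \ {a, a'} ∪ {a, a'}) := by
    apply rk_mono'
    intro z hz
    by_cases hz' : z ∈ ({a, a'} : Finset α)
    · exact mem_union_right _ hz'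
    · exact mem_union_left _ (mem_sdiff.2 ⟨hz, hz'⟩)
  rw [h5, hτ3, hX] at h6
  omega

end StarSharpPencilH

end PercRepro.Cogirth
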